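import Summits.ABC.StewartYu.PadicG3SatNPack
import Summits.ABC.StewartYu.PadicG3SatNEnd
import Summits.ABC.StewartYu.PadicG3SatOrdLine
import Summits.ABC.StewartYu.PadicG3SatFrameD
import HarnessLib

/-!
# Cell abc-stewartyu, WP-L.P(odd) (crux r3 `PadicCoreOddRat`, stmt-ABC-20503): `RecordSupplyOddSatRD (c^·) p n` FROM ONE RECORD PACKAGE
# (the lead's assembly of stub `stub_recordSat` of line `sat-odd` v2, modulo p1's record deliverables stated as ONE hypothesis)

`Summits/ABC/StewartYu/PadicG3SatNStub.lean` — cell `abc-stewartyu` (seat p2-g6, line lead; record owner p1 g11).  Proofs only; no definition, no named fact.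
For each saturated set-up `(S, F, V, Vmax, W)` under the supply's hypotheses, the RECORD PACKAGE `hR` delivers a `PadicG3ParN` record `P`
(field equations `p, θ₀ = 1/2, Nq = K ≥ 2, N = F.N, A = V`, the single budget letter `P.W ≥ W + log(n·n!·N)` and `≥ log N + log n! + 3 log n`),
the Siegel count (B1) in `N·∏(2sⱼ)` form, a smallness `‖Λ/b̃_{k₀}‖ ≤ e^{−U}` with the four budget inequalities of `ineqPackSat_schedN_one`,
and `RecordOdd (c^·) p n V Vmax W D0N S0NV (XfinOS (schedN 1)) DN` at the DATUM `W`.  This file wires it: directions `b̃ = bo ᵥ* C` have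
`log max(3,|b̃ₖ|) ≤ log(n·n!·N) + W ≤ 4ⁿ(W + log 2Vmax)` (`log_max_three_vecMul_le`, `N ≤ ∏ 2Vⱼ/log 2`), the `Λ`-order line
`ordLine_of_negBound_sat` (`c ≥ 256`), the pack `ineqPackSat_schedN_one`, the END sizing `endSizingSatN`, and `recordSupplyAtSatR_of_pack`.

* `log_N_le_of_prod` (`log N ≤ 2n·log(2Vmax)`), `Wb_le_pow` (`log(n·n!·N) + W ≤ 4ⁿ·(W + log 2Vmax)`), `recordSupplyOddSatRD_of_package`.

References: Yu. V. Nesterenko, LNM 1819 (2003) Prop 4.1, §5; K. Yu, Acta Math. 211 (2013) §7 (shape only).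
-/

noncomputable section

open Finset Real Matrix
open Literature.NumberTheory.Transcendental
open Literature.NumberTheory.Transcendental.CW77.Setup (Tau tauNorm)
open Summit.ABC.StewartYu.GenThreeFrameSpecOdd (RecordOdd)

namespace Summit.ABC.StewartYu

namespace G3Setup

variable {p : ℕ} [Fact p.Prime]

/-- `log N ≤ 2n·log(2Vmax)` from `N ≤ ∏ⱼ 2Vⱼ/log 2`, `1 ≤ Vⱼ ≤ Vmax` (`1/log 2 < 2 ≤ 2Vmax`). [folklore] -/
theorem log_N_le_of_prod {n N : ℕ} (hN : 1 ≤ N) {V : Fin n → ℝ} {Vmax : ℝ} (hV1 : ∀ j, 1 ≤ V j) (hVm : ∀ j, V j ≤ Vmax)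
    (hNV : (N : ℝ) ≤ ∏ j, (2 * V j / Real.log 2)) : Real.log N ≤ 2 * n * Real.log (2 * Vmax) := by
  have hl2 : (1 : ℝ) / 2 < Real.log 2 := by have := Real.log_two_gt_d9; linarith
  have hl20 : 0 < Real.log 2 := by linarith
  rcases Nat.eq_zero_or_pos n with hn | hn
  · subst hn
    simp only [Finset.univ_eq_empty, Finset.prod_empty] at hNV
    have : (N : ℝ) = 1 := le_antisymm hNV (by exact_mod_cast hN)
    rw [this, Real.log_one]; simp
  have hVmax : 1 ≤ Vmax := le_trans (hV1 ⟨0, hn⟩) (hVm ⟨0, hn⟩)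
  have hfac : ∀ j, 2 * V j / Real.log 2 ≤ (2 * Vmax) ^ 2 := by
    intro j
    rw [div_le_iff₀ hl20]
    have h1 : 2 * V j ≤ 2 * Vmax := by linarith [hVm j]
    nlinarith [hV1 j]
  have hprod : (N : ℝ) ≤ ((2 * Vmax) ^ 2) ^ n := by
    refine hNV.trans ?_
    calc ∏ j, (2 * V j / Real.log 2) ≤ ∏ _j : Fin n, (2 * Vmax) ^ 2 :=
          Finset.prod_le_prod (fun j _ => by have := hV1 j; positivity) fun j _ => hfac j
      _ = ((2 * Vmax) ^ 2) ^ n := by rw [Finset.prod_const, Finset.card_univ, Fintype.card_fin]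
  have hNpos : (0 : ℝ) < N := by exact_mod_cast hN
  calc Real.log N ≤ Real.log (((2 * Vmax) ^ 2) ^ n) := Real.log_le_log hNpos hprod
    _ = 2 * n * Real.log (2 * Vmax) := by rw [Real.log_pow, Real.log_pow]; push_cast; ring

/-- **The direction letter of the saturated frame is admissible for the `Λ`-line**: `log(n·(n!·N)) + W ≤ 4ⁿ·(W + log 2Vmax)`
(`n ≥ 1`, `W ≥ 1`, `log N ≤ 2n log 2Vmax`). [folklore] -/
theorem Wb_le_pow {n N : ℕ} (hn : 1 ≤ n) (hN : 1 ≤ N) {V : Fin n → ℝ} {Vmax W : ℝ} (hV1 : ∀ j, 1 ≤ V j) (hVm : ∀ j, V j ≤ Vmax)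
    (hW : 1 ≤ W) (hNV : (N : ℝ) ≤ ∏ j, (2 * V j / Real.log 2)) :
    Real.log ((n : ℝ) * ((n.factorial * N : ℕ) : ℝ)) + W ≤ 4 ^ n * (W + Real.log (2 * Vmax)) := by
  have hlogN := log_N_le_of_prod hN hV1 hVm hNV
  have hVmax : 1 ≤ Vmax := le_trans (hV1 ⟨0, hn⟩) (hVm ⟨0, hn⟩)
  have hL2 : 0 ≤ Real.log (2 * Vmax) := Real.log_nonneg (by linarith)
  have hnR : (1 : ℝ) ≤ n := by exact_mod_cast hn
  have hfa : (1 : ℝ) ≤ n.factorial := by exact_mod_cast n.factorial_pos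
  have hNR : (1 : ℝ) ≤ N := by exact_mod_cast hN
  -- `log n ≤ n − 1`, `log n! ≤ n·(n − 1)`
  have hlogn : Real.log n ≤ (n : ℝ) - 1 := Real.log_le_sub_one_of_pos (by linarith)
  have hlogfact : Real.log (n.factorial : ℝ) ≤ n * ((n : ℝ) - 1) := by
    have h1 : (n.factorial : ℝ) ≤ (n : ℝ) ^ n := by exact_mod_cast Nat.factorial_le_pow n
    calc Real.log (n.factorial : ℝ) ≤ Real.log ((n : ℝ) ^ n) := Real.log_le_log (by linarith) h1
      _ = n * Real.log n := by rw [Real.log_pow]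
      _ ≤ n * ((n : ℝ) - 1) := mul_le_mul_of_nonneg_left hlogn (by linarith)
  have hsplit : Real.log ((n : ℝ) * ((n.factorial * N : ℕ) : ℝ)) = Real.log n + Real.log n.factorial + Real.log N := by
    push_cast
    rw [Real.log_mul (by positivity) (by positivity), Real.log_mul (by positivity) (by positivity)]; ring
  rw [hsplit]
  -- `n² ≤ 4ⁿ`, `2n ≤ 4ⁿ − ...`: use `4ⁿ ≥ 1 + 3n` (Bernoulli) and `4ⁿ ≥ n²+2n` for `n ≥ 1`
  have hbern : (1 : ℝ) + n * 3 ≤ 4 ^ n := by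
    have := one_add_mul_le_pow (show (-2 : ℝ) ≤ 3 by norm_num) n
    norm_num at this ⊢; linarith
  have h4sq : (n : ℝ) ^ 2 + 2 * n ≤ 4 ^ n := by
    have key : ∀ m : ℕ, 1 ≤ m → (m : ℝ) ^ 2 + 2 * m ≤ 4 ^ m := by
      intro m hm
      induction m with
      | zero => omega
      | succ k ih =>
        rcases Nat.eq_zero_or_pos k with hk | hk
        · subst hk; norm_num
        · have := ih hk
          push_cast
          have h4 : (4 : ℝ) ^ (k + 1) = 4 * 4 ^ k := by rw [pow_succ]; ring
          rw [h4]
          have hk1 : (1 : ℝ) ≤ k := by exact_mod_cast hk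
          nlinarith
    exact key n hn
  nlinarith [mul_nonneg (sub_nonneg.mpr (one_le_pow₀ (by norm_num : (1 : ℝ) ≤ 4)) : (0 : ℝ) ≤ 4 ^ n - 1) (by linarith : (0 : ℝ) ≤ W - 1),
    mul_le_mul_of_nonneg_right (by linarith : (2 : ℝ) * n ≤ 4 ^ n) hL2]

/-- **`RecordSupplyOddSatRD (c^·) p n` FROM ONE RECORD PACKAGE** (`n ≥ 2`, `p` odd, `c ≥ 256`).  The package `hR` is what the record owner
proves for each admissible saturated set-up; everything else is the frame's algebra. [cite: Nesterenko2003, Prop 4.1, §5; shape only] -/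
theorem recordSupplyOddSatRD_of_package {n : ℕ} (hn2 : 2 ≤ n) (hp2 : p ≠ 2) {c : ℝ} (hc : 256 ≤ c)
    (hR : ∀ (S : G3Setup p) (F : S.SatData) (V : Fin S.n → ℝ) (Vmax W : ℝ), S.n = n →
      (∀ j, padicValRat p (F.αo j) = 0) → (∀ i, padicValRat p (S.α i) = 0) →
      (∀ j, Height.logHeight₁ (F.αo j) ≤ V j) → (∀ j, 1 ≤ V j) → (∀ j, V j ≤ Vmax) →
      (∀ j, Real.log (max 3 (|F.bo j| : ℝ)) ≤ W) → 1 ≤ W →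
      ¬ (padicValRat p (∏ j, F.αo j ^ F.bo j - 1) : ℝ) * Real.log p ≤
          c ^ S.n * ((p : ℝ) / Real.log p) * (∏ j, V j) * (W + Real.log p + Real.log (2 * Vmax)) →
      (F.N : ℝ) ≤ ∏ j, (2 * V j / Real.log 2) →
      (∀ j, (F.Ucol j : ℤ) ≤ (S.n : ℤ) * F.N) → (∀ j k, |F.C j k| ≤ ((S.n.factorial * F.N : ℕ) : ℤ)) →
      (∀ i, Height.logHeight₁ (S.α i) ≤ ∑ j, V j) → ((F.N : ℤ) = |F.C.det|) →
      ∃ (P : PadicG3ParN S.n) (U : ℝ), P.p = p ∧ P.θ₀ = 1 / 2 ∧ P.Nq = P.K ∧ 2 ≤ P.K ∧ P.N = F.N ∧ P.A = V ∧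
        Real.log F.N + Real.log S.n.factorial + 3 * Real.log S.n ≤ P.W ∧
        Real.log ((S.n : ℝ) * ((S.n.factorial * F.N : ℕ) : ℝ)) + W ≤ P.W ∧
        2 * (Icc (-(S.NS (P.schedN 1) 0 0 : ℤ)) (S.NS (P.schedN 1) 0 0) ×ˢ tauSetR S.n S.j₀ (S.TordS (P.schedN 1) 0 0)).card *
            ((p - 1) * p ^ P.m) ≤ (P.L0N + 1) * (F.N * ∏ j, (2 * S.sideS₂ (P.schedN 1) j)) ∧
        ‖S.Λ / (S.b S.j₀ : ℚ_[p])‖ ≤ Real.exp (-U) ∧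
        (∀ ν, ν + 1 ≤ S.n → P.L0N * (P.G + 1) +
          (4 * Real.log 2 + 2 * (Real.log ((P.L0N : ℝ) + 1) + S.n * Real.log (S.n * S.n.factorial * F.N * P.LV + 1)) +
            2 * (((69 / 4) * (S.n + 1) * P.LgV + 2 * (S.n + 1) * ((P.SdN : ℝ) - P.SdG)) * (P.SdN * Real.log 2 + 23 / 20 * P.HV + (P.HV + P.W))) +
            2 * (P.HV / Real.exp 1) + 2 * (P.L0N * ((P.SdN + S.n + 6) * Real.log 2)) + 2 * P.htsV 0 + 4 * P.htsV ν + 8 * ∑ j, P.A j) <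
          8 * 2 ^ ν * P.Zp) ∧
        (∀ lev ν, lev ≤ P.SdN → ν + 1 ≤ S.n → P.L0N * (P.G + 1) + P.AcondV lev ν +
          (4 * Real.log 2 + 2 * (Real.log ((P.L0N : ℝ) + 1) + S.n * Real.log (S.n * S.n.factorial * F.N * P.LV + 1)) +
            2 * (((69 / 4) * (S.n + 1) * P.LgV + 2 * (S.n + 1) * ((P.SdN : ℝ) - P.SdG)) * (P.SdN * Real.log 2 + 23 / 20 * P.HV + (P.HV + P.W))) +
            2 * (P.HV / Real.exp 1) + 2 * (P.L0N * ((P.SdN + S.n + 6) * Real.log 2)) + 2 * P.htsV 0 + 4 * P.htsV ν + 8 * ∑ j, P.A j) < U) ∧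
        (P.L0N * (P.G + 1) + 2 ^ (S.n + 1) *
          (6 * Real.log 2 + 2 * (Real.log ((P.L0N : ℝ) + 1) + S.n * Real.log (S.n * S.n.factorial * F.N * P.LV + 1)) +
            ((69 / 4) * (S.n + 1) * P.LgV + 2 * (S.n + 1) * ((P.SdN : ℝ) - P.SdG)) * (P.SdN * Real.log 2 + 23 / 20 * P.HV + (P.HV + P.W)) +
            2 * (P.HV / Real.exp 1) + 2 * (P.L0N * ((P.SdN + S.n + 6) * Real.log 2)) +
            8 * P.htsV 0 + (2 * P.LgV + (S.n + 1) * (8 * P.LgV + 2 * P.SdN)) * (P.SdN * Real.log 2 + Real.log 2 + 69 / 20 * P.HV + 2 * P.W + (P.HV + P.W)) +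
            (6 * S.n + 10) * ∑ j, P.A j) < 8 * 2 ^ S.n * P.Zp) ∧
        (∀ lev, lev < P.SdN → P.L0N * (P.G + 1) + P.AcondV lev S.n + 2 ^ (S.n + 1) *
          (6 * Real.log 2 + 2 * (Real.log ((P.L0N : ℝ) + 1) + S.n * Real.log (S.n * S.n.factorial * F.N * P.LV + 1)) +
            ((69 / 4) * (S.n + 1) * P.LgV + 2 * (S.n + 1) * ((P.SdN : ℝ) - P.SdG)) * (P.SdN * Real.log 2 + 23 / 20 * P.HV + (P.HV + P.W)) +
            2 * (P.HV / Real.exp 1) + 2 * (P.L0N * ((P.SdN + S.n + 6) * Real.log 2)) +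
            8 * P.htsV 0 + (2 * P.LgV + (S.n + 1) * (8 * P.LgV + 2 * P.SdN)) * (P.SdN * Real.log 2 + Real.log 2 + 69 / 20 * P.HV + 2 * P.W + (P.HV + P.W)) +
            (6 * S.n + 10) * ∑ j, P.A j) < U) ∧
        RecordOdd (fun m => c ^ m) p S.n V Vmax W P.D0N P.S0NV (S.XfinOS (P.schedN 1)) P.DN) :
    RecordSupplyOddSatRD (fun m => c ^ m) p n := by
  intro S F V Vmax W hSn hαv hθv hV hV1 hVm hWbo hW1 hneg hNV hUcol hCb hθV hdet
  have hn1 : 1 ≤ S.n := by omega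
  have hn2' : 2 ≤ S.n := by omega
  obtain ⟨P, U, hPp, hθ, hNq, hK2, hPN, hPA, hNCW, hWbW, hB1, hΛU, hKfar, hKlam, hHfar, hHlam, hrec⟩ :=
    hR S F V Vmax W hSn hαv hθv hV hV1 hVm hWbo hW1 hneg hNV hUcol hCb hθV hdet
  -- record-side hypotheses in `P`'s letters
  have hA1 : ∀ j, 1 ≤ P.A j := fun j => by rw [hPA]; exact hV1 j
  have hαA : ∀ j, Height.logHeight₁ (F.αo j) ≤ P.A j := fun j => by rw [hPA]; exact hV j
  have hθA : ∀ i, Height.logHeight₁ (S.α i) ≤ ∑ j, P.A j := fun i => by rw [hPA]; exact hθV i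
  -- the directions `b̃ = bo ᵥ* C`: `log max(3,|b̃ₖ|) ≤ log(n·(n!·N)) + W`
  have hM1 : 1 ≤ S.n.factorial * F.N := Nat.one_le_iff_ne_zero.mpr (Nat.mul_ne_zero S.n.factorial_pos.ne' (by have := F.hN; omega))
  have hbW' : ∀ k, Real.log (max 3 (|S.b k| : ℝ)) ≤ Real.log ((S.n : ℝ) * ((S.n.factorial * F.N : ℕ) : ℝ)) + W := by
    intro k
    have h := log_max_three_vecMul_le hn1 F.bo F.C hM1 hCb hWbo k
    rw [← F.hb] at h
    exact h
  have hbW : ∀ k, Real.log (max 3 (|S.b k| : ℝ)) ≤ P.W := fun k => (hbW' k).trans hWbW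
  -- the `Λ`-order line at the datum `W` with directions of size `Wb ≤ 4ⁿ(W + log 2Vmax)`
  have hWbR := Wb_le_pow (V := V) hn1 F.hN hV1 hVm hW1 hNV
  have hnegS : ¬ (padicValRat p (∏ j, S.α j ^ S.b j - 1) : ℝ) * Real.log p ≤
      c ^ S.n * ((p : ℝ) / Real.log p) * (∏ j, V j) * (W + Real.log p + Real.log (2 * Vmax)) := by
    rw [F.prod_zpow_b_eq]; exact hneg
  obtain ⟨hne, hord⟩ := S.ordLine_of_negBound_sat hp2 hn2' V Vmax W _ hV1 hVm hbW' hW1 hWbR hc hnegS P.toPadicG3Par hPp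
  -- the pack, the END sizing, the supply
  have hpack := S.ineqPackSat_schedN_one F P hPp hθ hn2' hA1 hαA hbW hCb hUcol hθA hdet hPN hNq hNCW hB1 hΛU hKfar hKlam hHfar hHlam
  obtain ⟨hXfin, hSfin, hD₀, hD⟩ := S.endSizingSatN F P 1 hPN hK2 le_rfl
  exact S.recordSupplyAtSatR_of_pack F (P.schedN 1) hn1 (fun m => c ^ m) V Vmax W _ _ _ _ hne hord hpack hXfin hSfin hD₀ hD hrec

end G3Setup

end Summit.ABC.StewartYu

end
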